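import Mathlib
import Literature.MathematicalPhysics.QuantumFieldTheory.Dimock2011to13.FreeFlowSingleStep
import Literature.MathematicalPhysics.QuantumFieldTheory.Balaban1983to89.Beta.GaussianIntegral

/-!
# Dimock, *The renormalization group according to Balaban* I §2.1 Lemma `second` / II §2.1 Lemma 2.1 (mabel) — THE
# ONE-STEP GAUSSIAN INTEGRATION: `∫ dΦ_k exp(−(a/2L²)‖Φ_{k+1} − QΦ_k‖² − (a_k/2)‖Φ_k − Q_kφ‖²) =
# 𝒵 · exp(−(a_{k+1}/2L²)‖Φ_{k+1} − Q_{k+1}φ‖²)` with `𝒵` explicit and independent of `(Φ_{k+1}, φ)`, and I §2.3 LEMMA `tiny` /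
# II §2.3 (cloudy3): the fluctuation integral of the free flow `= exp(−J_min)·(2π)^{|ι|/2}(det C_k)^{1/2}`, and (v1.1) II
# THEOREM 2.1's `φ_{Ω₁}`-integral (tony3) → (bombshell) = I §2.2 (third) → (only) — PROVED

**Citation header (reproduction of PUBLISHED work; template of the Bałaban lattice Yang–Mills cell).**
J. Dimock, *The renormalization group according to Balaban. I. Small fields*, Rev. Math. Phys. **25** (2013)
1330010 (= arXiv:1108.1335v2) [Dimock2013], §2.1: the step (kth) L417–424, LEMMA `\label{second}` L447–465 and its proof
L471–554 ((queen) L472–478, (kingmaker0) L484–492, (fifty) L532–535, the Gaussian step L538–545 with (queen2) L541–545)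
§2.2 "free flow": (third) L570–575, (norton) L577–580, the shift L603–608, (only) L610–620, (spiffy) L623–636; and §2.3
"single step free flow": (manx) L650–656, LEMMA `\label{tungsten}` L679–703, LEMMA `\label{tiny}` L748–759 with its proof
L762–794 ((undo) L766–772, (eighty) L774–781, (manx2) L787–794) (TeX source held by the cell,
`inputs/files/dimock/src/1108.1335/1108.1335.tex`, 7382e6540dded9be).  J. Dimock, *The
renormalization group according to Balaban. II. Large fields*, J. Math. Phys. **54** (2013) 092301 (= arXiv:1212.5562v2)
[Dimock2013BalabanII], §2.1: LEMMA 2.1 = `\label{mabel}` (the first `\begin{lem}` of the source) L488–493 and its proof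
L497–550 ((sweet) L499–507, (stringy) L510–512, (cherry0) L516–518, (psik) L521–524, (stringy2) L526–529, the Gaussian
step L531–543); §2.2 THEOREM 2.1 (sonnyboy) L594–614 with its proof (tony3) L618–655; §2.3: (thefirst) L716–729, the
expansion (expand) L886–895, (worry) L897–905 and the evaluated integral (cloudy3) L910–918; App. C L6578–6581 (TeX
`inputs/files/dimock/src/1212.5562/1212.5562.tex`, 75c5792fc48eacbc).  Dimock's papers are
published and refereed and are the cell's TEMPLATE, not manuscripts under audit; no quantity of the Bałaban series is
touched.

**What the papers print (verbatim).**  I (kth) L417–422: *"ρ̃_{k+1}(Φ_{k+1}) = 𝒩^{−1}_{aL,𝕋¹_{M+N−k}} ∫ exp(−(a/2L²)‖Φ_{k+1} −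
QΦ_k‖²) ρ_k(Φ_k) dΦ_k"*.  I L471–478: *"The proof is by induction. Assuming it is true for k we compute ρ̃_{k+1}(Φ_{k+1}) =
const ∫ exp(−½(a/L²)‖Φ_{k+1} − QΦ_k‖² − (a_k/2)‖Φ_k − Q_kφ‖²) ρ_0(φ_{L^k}) d^{(k)}φ dΦ_k  (queen)"*.  I L531–545: *"Combining
(tee) and (tea) gives the value at the minimum as (a/2L²)‖Φ_{k+1} − QΨ_k‖² + ½a_k‖Ψ_k − Q_kφ‖² = (a_{k+1}/2L²)‖Φ_{k+1} −
Q_{k+1}φ‖²  (fifty)  Now in the integral (queen) expand around the minimizer. We write Φ_k = Ψ_k + Z and integrate over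
Z. The term with no Z's is (fifty). The linear terms in Z vanish and the terms quadratic in Z when integrated over Z
yield a constant. Thus we have ρ̃_{k+1}(Φ_{k+1}) = const ∫ exp(−(a_{k+1}/2L²)‖Φ_{k+1} − Q_{k+1}φ‖²) ρ_0(φ_{L^k}) d^{(k)}φ
(queen2)"*.  II LEMMA 2.1 (L488–493): *"For some constant 𝒩_{k,Ω}  ρ_{k,Ω}(φ_{Ω₁ᶜ}, Φ_{k,Ω}) = 𝒩_{k,Ω}^{−1} ∫ exp(−½‖𝐚^{1/2}(Φ_{k,Ω}
− Q_{k,Ω}φ)‖²) ρ_0(φ_{L^k})"*.  II L508–513 and L531–543: *"To evaluate the integral over Φ_{k,Ω_{k+1}} we expand around the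
minimizer in Φ_{k,Ω_{k+1}} of (a/2L²)‖Φ_{k+1} − QΦ_k‖²_{Ω_{k+1}} + (a_k/2)‖Φ_k − Q_kφ‖²_{Ω_{k+1}}  (stringy)  This is a problem
already discussed in part I on the whole torus. The solution is the same here. … Now in (sweet) write Φ_{k,Ω_{k+1}} =
Ψ_{k,Ω_{k+1}} + Z (all functions on the unit lattice Ω^{(k)}_{k+1}) and integrate over Z instead of Φ_{k,Ω_{k+1}}. The terms
with no Z's are (stringy2), the terms linear in Z vanish, and the terms quadratic in Z when integrated over Z yield a
constant. Thus we have ρ̃_{k+1,Ω⁺}(φ_{Ω₁ᶜ}, Φ_{k+1,Ω⁺}) = const ∫ exp(−(a_{k+1}/2L²)‖Φ_{k+1} − Q_{k+1}φ‖²_{Ω_{k+1}} − ½Σ_{j=1}^k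
a^{(k)}_j‖Φ_j − Q_jφ‖²_{δΩ_j}) ρ_0(φ_{L^k}) dφ_{Ω₁}"*; L550: *"The constant 𝒩_{k,Ω}^{−1} can be evaluated by integrating over
all fields."*  I LEMMA `tiny` (L748–759): *"Let ρ_k(Φ_k) = Z_k exp(−S_k(Φ_k, φ_k)). Then ρ̃_{k+1} is given by ρ̃_{k+1}(Φ_{k+1}) =
Z_k 𝒩^{−1}_{aL,𝕋¹_{N+M−k}} (2π)^{|𝕋⁰_{M+N−k}|/2}(det C_k)^{1/2} exp(−S⁰_{k+1}(Φ_{k+1}, φ⁰_{k+1}))  (understand)  where C_k = (Δ_k +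
(a/L²)QᵀQ)^{−1}"*; its proof L762–794: *"We calculate ρ̃_{k+1} given in (manx) by expanding around the minimum is Φ_k. We we
write Φ_k = Ψ_k + Z and integrate over Z … instead of Φ_k. We have from (someday) φ_k(Ψ_k + Z) = φ⁰_{k+1} + 𝒵_k  (undo) … We
claim that J(Φ_{k+1}, Ψ_k + Z, φ⁰_{k+1} + 𝒵_k) = S⁰_{k+1}(Φ_{k+1}, φ⁰_{k+1}) + (a/2L²)‖QZ‖² + S_k(Z, 𝒵_k) = S⁰_{k+1}(Φ_{k+1}, φ⁰_{k+1}) +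
½⟨Z, (Δ_k + (a/L²)QᵀQ)Z⟩  (eighty) … Inserting this last expression into (manx) yields ρ̃_{k+1}(Φ_{k+1}) = 𝒩^{−1}_{aL,𝕋¹} Z_k
exp(−S⁰_{k+1}(Φ_{k+1}, φ⁰_{k+1})) ∫ exp(−½⟨Z, (Δ_k + (a/L²)QᵀQ)Z⟩) dZ  (manx2)  We evaluate the last integral as
(2π)^{|𝕋⁰_{M+N−k}|/2}(det C_k)^{1/2} which gives the result."*  II (cloudy3) L910–918: *"The original integral (thefirst) with Z as
the integration variable would now be evaluated as exp(−½⟨φ_{Ω₁ᶜ}, [−Δ + μ̄_k]_{Ω₁ᶜ}φ_{Ω₁ᶜ}⟩ − ⟨φ_{Ω₁ᶜ}, [−Δ]_{Ω₁,Ω₁ᶜ}φ⁰_{k+1,Ω⁺}⟩ −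
S⁰_{k+1}(Ω₁, Φ_{k+1,Ω⁺}, φ⁰_{k+1,Ω⁺})) ∫ exp(−½(Z, [Δ_{k,Ω} + (a/L²)QᵀQ]_{Ω_{k+1}}Z)) dZ"*.  II THEOREM 2.1 (L594–603):
*"Starting with the free density after k steps the density has the form ρ_{k,Ω}(φ_{Ω₁ᶜ}, Φ_{k,Ω}) = Z_{k,Ω} exp(−½‖𝐚^{1/2}(Φ_{k,Ω} −
Q_{k,Ω}φ)‖²_{Ω₁} − ½⟨φ, (−Δ + μ̄_k)φ⟩) … Here Z_{k,Ω} is a constant"*; its proof L646–655: *"Now in the exponent in (tony3)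
write φ_{Ω₁} = φ_{k,Ω} + 𝒵 and integrate over 𝒵 instead of φ_{Ω₁}. The term with no 𝒵's comes outside the integral and
gives the exponential in (bombshell). The term linear in 𝒵 vanishes. The term quadratic in 𝒵 is −½⟨𝒵, [−Δ + μ̄_k +
Qᵀ_{k,Ω}𝐚Q_{k,Ω}]_{Ω₁}𝒵⟩. Thus we have the result with Z_{k,Ω} = 𝒩_{k,Ω}^{−1} ∫ exp(−½⟨𝒵, [−Δ + μ̄_k + Qᵀ_{k,Ω}𝐚Q_{k,Ω}]_{Ω₁}𝒵⟩)
d𝒵"*.  I §2.2 L603–620: *"We shift the integration in (third) so it is centered on the minimum. We take φ = φ_k + 𝒵 … The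
cross terms vanish and so S_k(Φ_k, φ_k + 𝒵) = S_k(Φ_k, φ_k) + ½⟨𝒵, (−Δ + μ̄_k + a_kQ_kᵀQ_k)𝒵⟩ Then (third) becomes ρ_k(Φ_k) =
Z_k exp(−S_k(Φ_k, φ_k))  (only)  where Z_k = 𝒩^{−1}_{a_k,𝕋⁰} ∫ exp(−½⟨𝒵, (−Δ + μ̄^N_k + a_kQ_kᵀQ_k)𝒵⟩) d^{(k)}𝒵"*.

**What is reproduced here (kernel-checked, zero `sorry`).**  On the carrier of this lineage's `FreeFlowSingleStep`
(finite index types: `ι` = the unit sites integrated out (`Ω^{(k)}_{k+1}`, or the whole unit torus in I), `σ` = the next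
level, `κ` = the fine sites; `Q : Matrix σ ι ℝ` with `QQᵀ = I`, `Q_k : Matrix ι κ ℝ`, weights `a_k > 0`, `aL = a/L² ≥ 0`;
`stringy Q_k Q a_k aL Φ_{k+1} φ Φ_k` = (stringy), `Psi` = (psik), `oneStepH Q a_k aL = a_k + aL·QᵀQ` = the bracket of
(cherry0), `aNext a_k aL = a_kaL/(a_k + aL)` = `a_{k+1}L^{−2}`), with LEBESGUE MEASURE `volume` on `ι → ℝ` (= `dΦ_{k,Ω_{k+1}}`,
resp. `dΦ_k`):
* §1 **the constant is explicit**: `det_oneStepH`: `det(a_k + aL·QᵀQ) = a_k^{|ι|}·(1 + aL/a_k)^{|σ|}` (Sylvester's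
  `det(1 + AB) = det(1 + BA)` with `QQᵀ = I`), and `gaussConst Q a_k aL := √(2π)^{|ι|}/√det(a_k + aL·QᵀQ)` =
  `∫ exp(−½⟨Z, (a_k + aL·QᵀQ)Z⟩) dZ` (`gaussConst_eq_integral`, pv16's `Beta.GaussianIntegral.integral_exp_neg_half_quadForm`
  BY NAME), `gaussConst_pos`;
* §2 **THE ONE-STEP GAUSSIAN INTEGRATION** (`integral_exp_neg_stringy`): for every `Φ_{k+1} : σ → ℝ`, `φ : κ → ℝ`,
  `∫ Φ_k, exp(−stringy(Φ_k)) = gaussConst · exp(−(aNext a_k aL/2)‖Φ_{k+1} − QQ_kφ‖²)` — PROOF AS PRINTED: the completed square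
  about `Ψ_k` (`FreeFlowSingleStep.stringy_eq`: *"The term with no Z's is (fifty). The linear terms in Z vanish"*), the
  translation `Φ_k = Ψ_k + Z` (Lebesgue measure is translation invariant, `integral_sub_right_eq_self`) and *"the terms
  quadratic in Z when integrated over Z yield a constant"* (`integral_exp_neg_half_quadForm` for the positive-definite
  `oneStepH`, `FreeFlowSingleStep.oneStepH_posDef`); with `integrable_exp_neg_stringy`;
* §3 **the shape of (queen2) / II L535–543**: under a further `φ`-integration against ANY weight `ρ` (the print's
  `ρ_0(φ_{L^k}) d^{(k)}φ`, resp. the remaining factors `exp(−½Σ_j a^{(k)}_j‖Φ_j − Q_jφ‖²_{δΩ_j}) ρ_0`), the inner `Φ_k`-integral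
  may be replaced by `gaussConst · exp(−(a_{k+1}/2L²)‖Φ_{k+1} − Q_{k+1}φ‖²)` (`integral_integral_exp_neg_stringy_mul`), the
  constant coming out of the integral (*"= const ∫ exp(−(a_{k+1}/2L²)‖Φ_{k+1} − Q_{k+1}φ‖²) ρ_0(φ_{L^k}) d^{(k)}φ"*);
* §4 **I LEMMA `tiny` (understand) = II (thefirst) → (cloudy3): THE FLUCTUATION INTEGRAL OF THE FREE FLOW** on the carrier
  of `FreeFlowSingleStep` §3 (`J` = (thefirst)'s exponent `J_{Ω⁺}` with the `φ_{Ω₁ᶜ}`-coupling as a source, `D > 0`, `𝐚_τ ≥ 0`):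
  `bracket_posDef` (`[Δ_{k,Ω} + (a/L²)QᵀQ]_{Ω_{k+1}} > 0`), `fluctConst` := `√(2π)^{|ι|}/√det[Δ_{k,Ω} + (a/L²)QᵀQ]_{Ω_{k+1}}` =
  `(2π)^{|ι|/2}(det C_k)^{1/2}` (`fluctConst_eq`, `C_k` = App. C's `CkOr … aL 0` by `FreeFlowSingleStep.bracket_mul_CkOr`) =
  `∫ exp(−½⟨Z, […]Z⟩) dZ` (`fluctConst_eq_integral`), `exp_neg_J_minimizer_eq` ((undo)–(eighty): with the fine field at its
  minimizer for the given `Φ_{k,Ω_{k+1}}`, the integrand is `exp(−J_min)` times the Gaussian of the bracket centred at `Ψ`,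
  by `FreeFlowSingleStep.J_expand`, `minimizer_inl_add`, `minimizer_Psi_phi0`), and **`integral_exp_neg_J_minimizer`**:
  `∫ dΦ_{k,Ω_{k+1}} exp(−J(Φ_{k+1}, Φ_{k,Ω_{k+1}}, φ_{k,Ω}(Φ_{k,Ω_{k+1}}))) = exp(−J_min) · fluctConst` (primed form with `J_min =
  E′(φ⁰_{k+1,Ω⁺})` by `J_at_min` and the `(det C_k)^{1/2}` constant);
* §5 (v1.1, ADDITIVE) **II THEOREM 2.1's `φ_{Ω₁}`-INTEGRATION (tony3) → (bombshell) = I §2.2 (third) → (only)** on the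
  carrier of `MultiRegionFreeFlow` (`energy D 𝐚 Q_{k,Ω} Φ src φ` = minus the exponent of (tony3), `minimizer` = (unknown),
  `gInvO = G_{k,Ω}^{−1} = [−Δ + μ̄_k + Qᵀ𝐚Q]_{Ω₁}`): `fineConst` := `√(2π)^{|κ|}/√det(gInvO)` = `∫ exp(−½⟨𝒵, G_{k,Ω}^{−1}𝒵⟩) d𝒵`
  (`fineConst_eq_integral`, `fineConst_pos`), **`integral_exp_neg_energy`**: `∫ dφ_{Ω₁} exp(−E(φ)) = exp(−E(φ_{k,Ω})) ·
  fineConst` for every `Φ_{k,Ω}` and source (*"write φ_{Ω₁} = φ_{k,Ω} + 𝒵 and integrate over 𝒵 … The term with no 𝒵's comes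
  outside the integral … The term linear in 𝒵 vanishes"*; `MultiRegionFreeFlow.energy_eq_minimizer_add`, `gInvO_posDef`), and
  `integral_exp_neg_action`: `∫ dφ exp(−S_k(Φ_k, φ)) = Z·exp(−½⟨Φ_k, Δ_kΦ_k⟩)` (I (only) with Lemma 2.2 (rain)/(spiffy) =
  `MultiRegionFreeFlow.action_minimizer`);
* §6 a one-site instance (`ι = σ = κ = Unit`, `Q = Q_k = 1`, `a_k = aL = 1`: `∫ exp(−½(Φ' − x)² − ½(x − φ)²) dx =
  √π · exp(−¼(Φ' − φ)²)`).

**Readings (declared).**  (i) The integration variable is the whole block `Φ_k : ι → ℝ` with Lebesgue measure; the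
print's normalised measures `d^{(k)}φ`, `𝒩^{−1}` and the unit-lattice rescalings (scaleddensity)/(scale) are constants and
relabellings not represented — the theorem is the (queen) → (queen2) step for the `Φ_k`-integral at fixed `(Φ_{k+1}, φ)`,
which is where the Gaussian integration happens; `Q_{k+1}` is `QQ_k` (cf. `BlockAveragingComposition.qavg_succ` for the
lattice instance).  (ii) ORDER OF INTEGRATION: (queen) is a joint integral `d^{(k)}φ dΦ_k`; §3 is stated for the iterated
integral with the `Φ_k`-integration inside (Tonelli for the non-negative integrand is not re-proved here).  (iii) The
constant: print says *"yield a constant"* / *"For some constant 𝒩_{k,Ω}"*; here it is the explicit `gaussConst` (and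
`det_oneStepH` makes its `a_k, aL, |ι|, |σ|`-dependence explicit); the print's identification of the overall constant *"by
integrating over all fields"* (II L550, I L553) is not reproduced.

**Readings, continued.**  (iv) In §4 the integrand of (manx)/(thefirst) is taken with the fine field `φ_{Ω₁}` AT ITS
MINIMIZER for the given block variable (I: `ρ_k(Φ_k) = Z_k exp(−S_k(Φ_k, φ_k))`, `φ_k = φ_k(Φ_k)`; II: after the
`φ_{Ω₁}`-integration of Theorem 2.1), the `φ_{Ω₁ᶜ}`-coupling being `FreeFlowSingleStep`'s source `src`; the prefactors
`Z_k 𝒩^{−1}` and the `φ_{Ω₁ᶜ}`-only constant are not represented.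

**What is NOT claimed.**  The k-fold induction of Lemma `second` / Lemma 2.1 as a statement about the densities `ρ_k`
(measures on field space, the scalings between lattices, `𝒩`-bookkeeping); I's scaling lemma L797–848 ((lumpy)/(oooo),
`Z_{k+1}` (Ziterate)) and LEMMA `tungsten` beyond what `FreeFlowSingleStep` has (its (hunger)/(kingmaker)/(someday) =
`minimizer_Psi_phi0`, `J_at_min`); the region bookkeeping of II (the split
L508, the passive layers `δΩ_j` — these ride unchanged through §3's weight `ρ`); anything of B1–B16 (TEMPLATE.md §4.1 row
«D1 §2.1» ↔ B5 §A–§B (1.5)–(1.15) `Te^{−S} = Z(0)exp(−½⟨B, Δ^{(1)}B⟩)`, grade T for the abelian Gaussian core; B6 §A for the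
regions).  NOT summit progress; NOT a statement about any Bałaban paper; NOT continuum; NOT Clay.  Unit
`b2b-balaban-template` gen 30 (journal CLAIM D1D2-ONE-STEP-GAUSSIAN-INTEGRAL-KERNEL).

**Version.**  v1.1 — ADDITIVE to v1 (p202547, 2026-08-20, commit 36c45396c9fb; every v1 declaration byte-identical):
§5 «II Theorem 2.1's φ_{Ω₁}-integral (tony3) → (bombshell) = I §2.2 (third) → (only)» (`fineConst`, `fineConst_eq_integral`,
`fineConst_pos`, `integral_exp_neg_energy`, `integral_exp_neg_action`), the instance section renumbered §6, header
extended accordingly.  v1 — §1–§4 + instances.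
-/

noncomputable section

open MeasureTheory Matrix Real
open scoped Matrix
open Literature.MathematicalPhysics.QuantumFieldTheory.Dimock2011to13.FluctuationCovarianceIdentity (proj)
open Literature.MathematicalPhysics.QuantumFieldTheory.Dimock2011to13.MultiRegionFreeFlow
open Literature.MathematicalPhysics.QuantumFieldTheory.Dimock2011to13.FreeFlowSingleStep
open Literature.MathematicalPhysics.QuantumFieldTheory.Balaban1983to89.Beta.GaussianIntegral
  (integral_exp_neg_half_quadForm integrable_exp_neg_half_quadForm)

namespace Literature.MathematicalPhysics.QuantumFieldTheory.Dimock2011to13.GaussianSingleStep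

variable {κ ι σ : Type*} [Fintype κ] [Fintype ι] [Fintype σ] [DecidableEq κ] [DecidableEq ι] [DecidableEq σ]

/-! ## §1 The constant: `det(a_k + aL·QᵀQ)` and `𝒵 = √(2π)^{|ι|}/√det` -/

/-- **`det(a_k + aL·QᵀQ) = a_k^{|ι|}(1 + aL/a_k)^{|σ|}`** for `QQᵀ = I_σ`, `a_k ≠ 0` (Sylvester's determinant identity): the
`(Φ_{k+1}, φ)`-independent Gaussian constant of the step, made explicit. [cite: Dimock2013, §2.1 Lemma second proof L538–545
(arXiv:1108.1335v2 TeX); Dimock2013BalabanII, §2.1 Lemma 2.1 proof L531–534 (arXiv:1212.5562v2 TeX)] -/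
theorem det_oneStepH {Q : Matrix σ ι ℝ} (hQ : Q * Qᵀ = 1) {ak : ℝ} (hak : ak ≠ 0) (aL : ℝ) :
    (oneStepH Q ak aL).det = ak ^ Fintype.card ι * (1 + aL / ak) ^ Fintype.card σ := by
  have h1 : oneStepH Q ak aL = ak • (1 + ((aL / ak) • Qᵀ) * Q) := by
    unfold oneStepH proj
    rw [smul_add, smul_one_eq_diagonal, Matrix.smul_mul, smul_smul, mul_div_cancel₀ _ hak]
  rw [h1, det_smul, det_one_add_mul_comm, Matrix.mul_smul, hQ, show (1 : Matrix σ σ ℝ) + (aL / ak) • (1 : Matrix σ σ ℝ)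
    = (1 + aL / ak) • (1 : Matrix σ σ ℝ) by rw [add_smul, one_smul], det_smul, det_one, mul_one]

/-- **the Gaussian constant of the step** `𝒵 = √(2π)^{|ι|}/√det(a_k + aL·QᵀQ)` (*"the terms quadratic in Z when integrated
over Z yield a constant"*). [cite: Dimock2013, §2.1 Lemma second proof L538–545 (arXiv:1108.1335v2 TeX); Dimock2013BalabanII,
§2.1 Lemma 2.1 proof L531–534 (arXiv:1212.5562v2 TeX)] -/
def gaussConst (Q : Matrix σ ι ℝ) (ak aL : ℝ) : ℝ :=
  Real.sqrt (2 * π) ^ Fintype.card ι / Real.sqrt (oneStepH Q ak aL).det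

omit [Fintype κ] [DecidableEq κ] [DecidableEq σ] in
/-- `𝒵 = ∫ exp(−½⟨Z, (a_k + aL·QᵀQ)Z⟩) dZ` — the integral over the fluctuation `Z` (pv16's Gaussian integral of a
positive-definite form, BY NAME). [cite: Dimock2013, §2.1 Lemma second proof L538–545 (arXiv:1108.1335v2 TeX);
Dimock2013BalabanII, §2.1 Lemma 2.1 proof L531–534 (arXiv:1212.5562v2 TeX)] -/
theorem gaussConst_eq_integral (Q : Matrix σ ι ℝ) {ak aL : ℝ} (hak : 0 < ak) (haL : 0 ≤ aL) :
    gaussConst Q ak aL = ∫ Z : ι → ℝ, Real.exp (-(1/2 : ℝ) * (Z ⬝ᵥ oneStepH Q ak aL *ᵥ Z)) := by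
  rw [gaussConst, integral_exp_neg_half_quadForm _ (oneStepH_posDef hak haL)]

omit [Fintype κ] [DecidableEq κ] [DecidableEq σ] in
/-- `𝒵 > 0`. [cite: Dimock2013BalabanII, §2.1 Lemma 2.1 L488 *"For some constant 𝒩_{k,Ω}"* (arXiv:1212.5562v2 TeX)] -/
theorem gaussConst_pos (Q : Matrix σ ι ℝ) {ak aL : ℝ} (hak : 0 < ak) (haL : 0 ≤ aL) : 0 < gaussConst Q ak aL :=
  div_pos (pow_pos (Real.sqrt_pos.mpr (by positivity)) _) (Real.sqrt_pos.mpr (oneStepH_posDef hak haL).det_pos)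

/-! ## §2 The one-step Gaussian integration -/

section Step

variable {Qk : Matrix ι κ ℝ} {Q : Matrix σ ι ℝ} {ak aL : ℝ}

omit [DecidableEq κ] in
/-- the integrand after completing the square: `exp(−stringy(Φ_k)) = exp(−(a′/2)‖Φ_{k+1} − Q_{k+1}φ‖²) · exp(−½⟨Φ_k − Ψ_k,
(a_k + aL·QᵀQ)(Φ_k − Ψ_k)⟩)` (*"The term with no Z's is (fifty). The linear terms in Z vanish"*).
[cite: Dimock2013, §2.1 Lemma second proof L538–540 (arXiv:1108.1335v2 TeX); Dimock2013BalabanII, §2.1 L531–534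
(arXiv:1212.5562v2 TeX)] -/
theorem exp_neg_stringy_eq (hQ : Q * Qᵀ = 1) (h : ak + aL ≠ 0) (Φ' : σ → ℝ) (φ : κ → ℝ) (Φι : ι → ℝ) :
    Real.exp (-stringy Qk Q ak aL Φ' φ Φι)
      = Real.exp (-(aNext ak aL / 2) * ((Φ' - Q *ᵥ (Qk *ᵥ φ)) ⬝ᵥ (Φ' - Q *ᵥ (Qk *ᵥ φ))))
        * Real.exp (-(1/2 : ℝ) * ((Φι - Psi Qk Q ak aL Φ' φ) ⬝ᵥ
            oneStepH Q ak aL *ᵥ (Φι - Psi Qk Q ak aL Φ' φ))) := by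
  rw [stringy_eq hQ h Φ' φ Φι, ← Real.exp_add]
  congr 1
  ring

omit [DecidableEq κ] in
/-- integrability of `exp(−stringy(Φ_k))` in `Φ_k` (a Gaussian of the positive-definite `a_k + aL·QᵀQ`, shifted by `Ψ_k`,
times a constant). [cite: Dimock2013BalabanII, §2.1 Lemma 2.1 proof L531–534 (arXiv:1212.5562v2 TeX)] -/
theorem integrable_exp_neg_stringy (hQ : Q * Qᵀ = 1) (hak : 0 < ak) (haL : 0 ≤ aL) (Φ' : σ → ℝ) (φ : κ → ℝ) :
    Integrable (fun Φι : ι → ℝ => Real.exp (-stringy Qk Q ak aL Φ' φ Φι)) := by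
  have h : ak + aL ≠ 0 := by positivity
  simp_rw [exp_neg_stringy_eq hQ h Φ' φ]
  refine Integrable.const_mul ?_ _
  have hint := integrable_exp_neg_half_quadForm _ (oneStepH_posDef (Q := Q) hak haL)
  exact hint.comp_sub_right (Psi Qk Q ak aL Φ' φ)

omit [DecidableEq κ] in
/-- **THE ONE-STEP GAUSSIAN INTEGRATION** ((queen) → (queen2); (sweet) → II L535–543): for every `Φ_{k+1}` and `φ`,
`∫ dΦ_k exp(−(aL/2)‖Φ_{k+1} − QΦ_k‖² − (a_k/2)‖Φ_k − Q_kφ‖²) = 𝒵 · exp(−(a_{k+1}L^{−2}/2)‖Φ_{k+1} − Q_{k+1}φ‖²)`, `a_{k+1}L^{−2} =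
aNext a_k aL`, `Q_{k+1} = QQ_k`, `𝒵 = gaussConst Q a_k aL` independent of `(Φ_{k+1}, φ)` — *"We write Φ_k = Ψ_k + Z and
integrate over Z. The term with no Z's is (fifty). The linear terms in Z vanish and the terms quadratic in Z when
integrated over Z yield a constant."* [cite: Dimock2013, §2.1 Lemma second L447–465 with proof (queen)–(queen2) L471–545
(arXiv:1108.1335v2 TeX); Dimock2013BalabanII, §2.1 Lemma 2.1 (mabel) L488–493 with proof L497–543 (arXiv:1212.5562v2 TeX)] -/
theorem integral_exp_neg_stringy (hQ : Q * Qᵀ = 1) (hak : 0 < ak) (haL : 0 ≤ aL) (Φ' : σ → ℝ) (φ : κ → ℝ) :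
    ∫ Φι : ι → ℝ, Real.exp (-stringy Qk Q ak aL Φ' φ Φι)
      = gaussConst Q ak aL
        * Real.exp (-(aNext ak aL / 2) * ((Φ' - Q *ᵥ (Qk *ᵥ φ)) ⬝ᵥ (Φ' - Q *ᵥ (Qk *ᵥ φ)))) := by
  have h : ak + aL ≠ 0 := by positivity
  simp_rw [exp_neg_stringy_eq hQ h Φ' φ]
  rw [integral_const_mul,
    integral_sub_right_eq_self (μ := (volume : Measure (ι → ℝ)))
      (fun Z : ι → ℝ => Real.exp (-(1/2 : ℝ) * (Z ⬝ᵥ oneStepH Q ak aL *ᵥ Z))) (Psi Qk Q ak aL Φ' φ),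
    ← gaussConst_eq_integral Q hak haL, mul_comm]

omit [DecidableEq κ] in
/-- the same with the printed left-hand side spelled out. [cite: Dimock2013, §2.1 (queen) L472–478 and (queen2) L541–545
(arXiv:1108.1335v2 TeX); Dimock2013BalabanII, §2.1 (sweet) L499–507 and L535–543 (arXiv:1212.5562v2 TeX)] -/
theorem integral_exp_neg_stringy' (hQ : Q * Qᵀ = 1) (hak : 0 < ak) (haL : 0 ≤ aL) (Φ' : σ → ℝ) (φ : κ → ℝ) :
    ∫ Φι : ι → ℝ, Real.exp (-((aL / 2) * ((Φ' - Q *ᵥ Φι) ⬝ᵥ (Φ' - Q *ᵥ Φι))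
        + (ak / 2) * ((Φι - Qk *ᵥ φ) ⬝ᵥ (Φι - Qk *ᵥ φ))))
      = gaussConst Q ak aL
        * Real.exp (-(aNext ak aL / 2) * ((Φ' - Q *ᵥ (Qk *ᵥ φ)) ⬝ᵥ (Φ' - Q *ᵥ (Qk *ᵥ φ)))) :=
  integral_exp_neg_stringy hQ hak haL Φ' φ

/-! ## §3 The shape of (queen2): the constant comes out of a further `φ`-integration -/

omit [DecidableEq κ] in
/-- **(queen) → (queen2) under the `φ`-integral**: for ANY weight `ρ` of the fine field (print: `ρ_0(φ_{L^k})`, together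
with any further `Φ_k`-independent factors) and any measure `ν` on the fine fields,
`∫ ν(dφ) ρ(φ) ∫ dΦ_k exp(−stringy) = 𝒵 · ∫ ν(dφ) ρ(φ) exp(−(a_{k+1}L^{−2}/2)‖Φ_{k+1} − Q_{k+1}φ‖²)` (iterated form; reading (ii)).
[cite: Dimock2013, §2.1 Lemma second proof (queen2) L540–545 (arXiv:1108.1335v2 TeX); Dimock2013BalabanII, §2.1 Lemma 2.1
proof L534–543 (arXiv:1212.5562v2 TeX)] -/
theorem integral_integral_exp_neg_stringy_mul (hQ : Q * Qᵀ = 1) (hak : 0 < ak) (haL : 0 ≤ aL) (Φ' : σ → ℝ)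
    (ν : Measure (κ → ℝ)) (ρ : (κ → ℝ) → ℝ) :
    ∫ φ, ρ φ * (∫ Φι : ι → ℝ, Real.exp (-stringy Qk Q ak aL Φ' φ Φι)) ∂ν
      = gaussConst Q ak aL
        * ∫ φ, ρ φ * Real.exp (-(aNext ak aL / 2) * ((Φ' - Q *ᵥ (Qk *ᵥ φ)) ⬝ᵥ (Φ' - Q *ᵥ (Qk *ᵥ φ)))) ∂ν := by
  rw [← integral_const_mul]
  refine integral_congr_ae (Filter.Eventually.of_forall fun φ => ?_)
  simp only [integral_exp_neg_stringy hQ hak haL Φ' φ]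
  ring

end Step

/-! ## §4 The fluctuation integral of the free flow: I Lemma `tiny` (understand), II (cloudy3) -/

section Fluct

variable {τ : Type*} [Fintype τ]
variable {D : Matrix κ κ ℝ} {ak : ℝ} {aτ : Matrix τ τ ℝ} {Qk : Matrix ι κ ℝ} {Qτ : Matrix τ κ ℝ} {Q : Matrix σ ι ℝ}
  {aL : ℝ}

omit [DecidableEq σ] in
/-- **the bracket `[Δ_{k,Ω} + (a/L²)QᵀQ]_{Ω_{k+1}}` of (expand)/(eighty) is positive definite** (`a_k > 0`, `aL ≥ 0`, `D > 0`,
`𝐚_τ ≥ 0`): the `Z`-integral (cloudy3)/(manx2) is a genuine Gaussian. [cite: Dimock2013BalabanII, §2.3 (expand) L886–895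
and (cloudy3) L910–918 (arXiv:1212.5562v2 TeX); Dimock2013, §2.3 (eighty) L774–781 (arXiv:1108.1335v2 TeX)] -/
theorem bracket_posDef (hD : D.PosDef) (haτ : aτ.PosSemidef) (hak : 0 < ak) (haL : 0 ≤ aL) :
    ((DeltakO D (weightO ak aτ) (rowsO Qk Qτ)).toBlocks₁₁ + aL • proj Q).PosDef := by
  refine PosDef.add_posSemidef (DeltakO_toBlocks₁₁_posDef hD haτ hak) ?_
  have h := Matrix.posSemidef_conjTranspose_mul_self Q
  rw [conjTranspose_eq_transpose_of_trivial] at h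
  exact h.smul haL

/-- **the fluctuation constant** `(2π)^{|ι|/2}(det C_k)^{1/2}` with `C_k = [Δ_{k,Ω} + (a/L²)QᵀQ]^{−1}_{Ω_{k+1}}`, written as
`√(2π)^{|ι|}/√det[Δ_{k,Ω} + (a/L²)QᵀQ]_{Ω_{k+1}}`. [cite: Dimock2013, §2.3 Lemma tiny (understand) L748–759 (arXiv:1108.1335v2
TeX); Dimock2013BalabanII, §2.3 (cloudy3) L910–918 (arXiv:1212.5562v2 TeX)] -/
def fluctConst (D : Matrix κ κ ℝ) (ak : ℝ) (aτ : Matrix τ τ ℝ) (Qk : Matrix ι κ ℝ) (Qτ : Matrix τ κ ℝ)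
    (Q : Matrix σ ι ℝ) (aL : ℝ) : ℝ :=
  Real.sqrt (2 * π) ^ Fintype.card ι
    / Real.sqrt ((DeltakO D (weightO ak aτ) (rowsO Qk Qτ)).toBlocks₁₁ + aL • proj Q).det

/-- `(2π)^{|ι|/2}(det C_k)^{1/2}`-form of the constant: `det C_k = (det[Δ_{k,Ω} + (a/L²)QᵀQ]_{Ω_{k+1}})⁻¹`, `C_k` = App. C's
`C_{k,Ω⁺,r}` at `r = 0` (`MultiRegionFreeFlow.CkOr … aL 0`, by `FreeFlowSingleStep.bracket_mul_CkOr`).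
[cite: Dimock2013, §2.3 Lemma tiny (understand) L752–758 (arXiv:1108.1335v2 TeX); Dimock2013BalabanII, App. C L6578–6581
(arXiv:1212.5562v2 TeX)] -/
theorem fluctConst_eq (hD : D.PosDef) (haτ : aτ.PosSemidef) (hQ : Q * Qᵀ = 1) (hak : 0 < ak) (haL : 0 ≤ aL) :
    fluctConst D ak aτ Qk Qτ Q aL
      = Real.sqrt (2 * π) ^ Fintype.card ι * Real.sqrt (CkOr D ak aτ Qk Qτ Q aL 0).det := by
  have hBC := bracket_mul_CkOr (Qk := Qk) (Qτ := Qτ) hD haτ hQ hak haL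
  have hdet : ((DeltakO D (weightO ak aτ) (rowsO Qk Qτ)).toBlocks₁₁ + aL • proj Q).det
      * (CkOr D ak aτ Qk Qτ Q aL 0).det = 1 := by
    rw [← det_mul, hBC, det_one]
  have hpos : 0 < ((DeltakO D (weightO ak aτ) (rowsO Qk Qτ)).toBlocks₁₁ + aL • proj Q).det :=
    (bracket_posDef hD haτ hak haL).det_pos
  have hC : (CkOr D ak aτ Qk Qτ Q aL 0).det
      = (((DeltakO D (weightO ak aτ) (rowsO Qk Qτ)).toBlocks₁₁ + aL • proj Q).det)⁻¹ := by
    rw [mul_comm] at hdet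
    exact eq_inv_of_mul_eq_one_left hdet
  rw [fluctConst, hC, Real.sqrt_inv, div_eq_mul_inv]

omit [DecidableEq σ] in
/-- `(2π)^{|ι|/2}(det C_k)^{1/2} = ∫ exp(−½⟨Z, [Δ_{k,Ω} + (a/L²)QᵀQ]_{Ω_{k+1}}Z⟩) dZ` — *"We evaluate the last integral as
(2π)^{|𝕋⁰|/2}(det C_k)^{1/2}"* (pv16's Gaussian integral of a positive-definite form, BY NAME). [cite: Dimock2013, §2.3 Lemma tiny
proof (manx2) L786–794 (arXiv:1108.1335v2 TeX); Dimock2013BalabanII, §2.3 (cloudy3) L916 (arXiv:1212.5562v2 TeX)] -/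
theorem fluctConst_eq_integral (hD : D.PosDef) (haτ : aτ.PosSemidef) (hak : 0 < ak) (haL : 0 ≤ aL) :
    fluctConst D ak aτ Qk Qτ Q aL
      = ∫ Z : ι → ℝ, Real.exp (-(1/2 : ℝ) *
          (Z ⬝ᵥ ((DeltakO D (weightO ak aτ) (rowsO Qk Qτ)).toBlocks₁₁ + aL • proj Q) *ᵥ Z)) := by
  rw [fluctConst, integral_exp_neg_half_quadForm _ (bracket_posDef hD haτ hak haL)]

/-- the integrand of (manx)/(thefirst) after the expansion (eighty)/(expand): with the fine field AT ITS MINIMIZER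
`φ_{k,Ω}(φ_{Ω₁ᶜ}, Φ_{k,Ω})` for the given `Φ_{k,Ω_{k+1}}`, `exp(−J(Φ_{k+1}, Φ_{k,Ω_{k+1}}, φ_{k,Ω}(Φ_{k,Ω_{k+1}}))) = exp(−J_min) ·
exp(−½⟨Φ_{k,Ω_{k+1}} − Ψ, [Δ_{k,Ω} + (a/L²)QᵀQ]_{Ω_{k+1}}(Φ_{k,Ω_{k+1}} − Ψ)⟩)` (*"φ_k(Ψ_k + Z) = φ⁰_{k+1} + 𝒵_k  (undo)"*,
`FreeFlowSingleStep.J_expand` at `Z = Φ_{k,Ω_{k+1}} − Ψ`). [cite: Dimock2013, §2.3 Lemma tiny proof (undo)–(eighty) L763–784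
(arXiv:1108.1335v2 TeX); Dimock2013BalabanII, §2.3 L871–895 (arXiv:1212.5562v2 TeX)] -/
theorem exp_neg_J_minimizer_eq (hD : D.PosDef) (haτ : aτ.PosSemidef) (hQ : Q * Qᵀ = 1) (hak : 0 < ak)
    (haL : 0 ≤ aL) (Φ' : σ → ℝ) (Φτ : τ → ℝ) (src : κ → ℝ) (Φι : ι → ℝ) :
    Real.exp (-FreeFlowSingleStep.J D ak aτ Qk Qτ Q aL Φ' Φτ src Φι (minimizer D (weightO ak aτ) (rowsO Qk Qτ) (Sum.elim Φι Φτ) src))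
      = Real.exp (-FreeFlowSingleStep.J D ak aτ Qk Qτ Q aL Φ' Φτ src (Psi Qk Q ak aL Φ' (phi0 D ak aτ Qk Qτ Q aL Φ' Φτ src))
            (phi0 D ak aτ Qk Qτ Q aL Φ' Φτ src))
        * Real.exp (-(1/2 : ℝ) * ((Φι - Psi Qk Q ak aL Φ' (phi0 D ak aτ Qk Qτ Q aL Φ' Φτ src)) ⬝ᵥ
            ((DeltakO D (weightO ak aτ) (rowsO Qk Qτ)).toBlocks₁₁ + aL • proj Q) *ᵥ
              (Φι - Psi Qk Q ak aL Φ' (phi0 D ak aτ Qk Qτ Q aL Φ' Φτ src)))) := by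
  set Ψ := Psi Qk Q ak aL Φ' (phi0 D ak aτ Qk Qτ Q aL Φ' Φτ src) with hΨ
  have hmin : minimizer D (weightO ak aτ) (rowsO Qk Qτ) (Sum.elim Φι Φτ) src
      = phi0 D ak aτ Qk Qτ Q aL Φ' Φτ src + calZ D ak aτ Qk Qτ (Φι - Ψ) := by
    have h := minimizer_inl_add (D := D) (ak := ak) (aτ := aτ) (Qk := Qk) (Qτ := Qτ) Ψ (Φι - Ψ) Φτ src
    rw [add_sub_cancel, hΨ, minimizer_Psi_phi0 hD haτ hak haL] at h
    rw [hΨ]; exact h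
  have key := J_expand (Qk := Qk) (Qτ := Qτ) hD haτ hQ hak haL Φ' Φτ src (Φι - Ψ)
  rw [← hΨ, add_sub_cancel] at key
  rw [hmin, key, ← Real.exp_add]
  congr 1
  ring

/-- **I LEMMA `tiny` (understand) = II (thefirst) → (cloudy3): THE FLUCTUATION INTEGRAL OF THE FREE FLOW.**  Integrating the
block variable `Φ_{k,Ω_{k+1}}` with the fine field at its minimizer:
`∫ dΦ_{k,Ω_{k+1}} exp(−J_{Ω⁺}(Φ_{k+1}, Φ_{k,Ω}, φ_{k,Ω}(φ_{Ω₁ᶜ}, Φ_{k,Ω}))) = exp(−J_min) · (2π)^{|ι|/2}(det C_k)^{1/2}`, `J_min` = the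
value at the joint minimizer `(Ψ, φ⁰_{k+1,Ω⁺})` (= `S⁰_{k+1}(Φ_{k+1}, φ⁰_{k+1}) + …` by `FreeFlowSingleStep.J_at_min`), `C_k = [Δ_{k,Ω} +
(a/L²)QᵀQ]^{−1}_{Ω_{k+1}}` — *"We write Φ_k = Ψ_k + Z and integrate over Z … Inserting this last expression into (manx) yields
(manx2) … We evaluate the last integral as (2π)^{|𝕋⁰_{M+N−k}|/2}(det C_k)^{1/2} which gives the result."*
[cite: Dimock2013, §2.3 Lemma tiny (understand) L748–759 with proof (undo)–(manx2) L762–794 (arXiv:1108.1335v2 TeX);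
Dimock2013BalabanII, §2.3 (expand) L886–895 and (cloudy3) L910–918 (arXiv:1212.5562v2 TeX)] -/
theorem integral_exp_neg_J_minimizer (hD : D.PosDef) (haτ : aτ.PosSemidef) (hQ : Q * Qᵀ = 1) (hak : 0 < ak)
    (haL : 0 ≤ aL) (Φ' : σ → ℝ) (Φτ : τ → ℝ) (src : κ → ℝ) :
    ∫ Φι : ι → ℝ, Real.exp (-FreeFlowSingleStep.J D ak aτ Qk Qτ Q aL Φ' Φτ src Φι
        (minimizer D (weightO ak aτ) (rowsO Qk Qτ) (Sum.elim Φι Φτ) src))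
      = Real.exp (-FreeFlowSingleStep.J D ak aτ Qk Qτ Q aL Φ' Φτ src (Psi Qk Q ak aL Φ' (phi0 D ak aτ Qk Qτ Q aL Φ' Φτ src))
            (phi0 D ak aτ Qk Qτ Q aL Φ' Φτ src))
        * fluctConst D ak aτ Qk Qτ Q aL := by
  simp_rw [exp_neg_J_minimizer_eq hD haτ hQ hak haL Φ' Φτ src]
  rw [integral_const_mul,
    integral_sub_right_eq_self (μ := (volume : Measure (ι → ℝ)))
      (fun Z : ι → ℝ => Real.exp (-(1/2 : ℝ) *
        (Z ⬝ᵥ ((DeltakO D (weightO ak aτ) (rowsO Qk Qτ)).toBlocks₁₁ + aL • proj Q) *ᵥ Z)))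
      (Psi Qk Q ak aL Φ' (phi0 D ak aτ Qk Qτ Q aL Φ' Φτ src)),
    ← fluctConst_eq_integral hD haτ hak haL]

/-- the same with the value at the minimum written as the next-level exponent `E′(φ⁰_{k+1,Ω⁺})` (Lemma 2.3 (nono) =
`FreeFlowSingleStep.J_at_min`; in I: `S⁰_{k+1}(Φ_{k+1}, φ⁰_{k+1})`) and the constant as `(2π)^{|ι|/2}(det C_k)^{1/2}`.
[cite: Dimock2013, §2.3 Lemma tiny (understand) L752–754 (arXiv:1108.1335v2 TeX); Dimock2013BalabanII, §2.3 (cloudy3)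
L911–916 (arXiv:1212.5562v2 TeX)] -/
theorem integral_exp_neg_J_minimizer' (hD : D.PosDef) (haτ : aτ.PosSemidef) (hQ : Q * Qᵀ = 1) (hak : 0 < ak)
    (haL : 0 ≤ aL) (Φ' : σ → ℝ) (Φτ : τ → ℝ) (src : κ → ℝ) :
    ∫ Φι : ι → ℝ, Real.exp (-FreeFlowSingleStep.J D ak aτ Qk Qτ Q aL Φ' Φτ src Φι
        (minimizer D (weightO ak aτ) (rowsO Qk Qτ) (Sum.elim Φι Φτ) src))
      = Real.exp (-energyNext D ak aτ Qk Qτ Q aL Φ' Φτ src (phi0 D ak aτ Qk Qτ Q aL Φ' Φτ src))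
        * (Real.sqrt (2 * π) ^ Fintype.card ι * Real.sqrt (CkOr D ak aτ Qk Qτ Q aL 0).det) := by
  have h : ak + aL ≠ 0 := by positivity
  rw [integral_exp_neg_J_minimizer hD haτ hQ hak haL, J_at_min hQ h, fluctConst_eq hD haτ hQ hak haL]

end Fluct

/-! ## §5 The `φ_{Ω₁}`-integral of II Theorem 2.1 ((tony3) → (bombshell)) = I §2.2 (third) → (only) -/

section Sonnyboy

variable {m : Type*} [Fintype m] [DecidableEq m]
variable {D : Matrix κ κ ℝ} {a : Matrix m m ℝ} {Qm : Matrix m κ ℝ}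

/-- **the fine-field constant** `Z_{k,Ω}·𝒩_{k,Ω} = ∫ exp(−½⟨𝒵, [−Δ + μ̄_k + Qᵀ_{k,Ω}𝐚Q_{k,Ω}]_{Ω₁}𝒵⟩) d𝒵` in closed form
`√(2π)^{|κ|}/√det(D + Qᵀ𝐚Q)` (`D = [−Δ + μ̄_k]_{Ω₁}`, `MultiRegionFreeFlow.gInvO D 𝐚 Q = G_{k,Ω}^{−1}`).
[cite: Dimock2013BalabanII, Thm 2.1 proof L649–655 (arXiv:1212.5562v2 TeX); Dimock2013, §2.2 (only) L610–620
(arXiv:1108.1335v2 TeX)] -/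
def fineConst (D : Matrix κ κ ℝ) (a : Matrix m m ℝ) (Qm : Matrix m κ ℝ) : ℝ :=
  Real.sqrt (2 * π) ^ Fintype.card κ / Real.sqrt (gInvO D a Qm).det

omit [DecidableEq m] in
/-- `Z = ∫ exp(−½⟨𝒵, G_{k,Ω}^{−1}𝒵⟩) d𝒵` (pv16's Gaussian integral of the positive-definite `G_{k,Ω}^{−1}` =
`MultiRegionFreeFlow.gInvO_posDef`, BY NAME). [cite: Dimock2013BalabanII, Thm 2.1 proof L649–655 (arXiv:1212.5562v2 TeX);
Dimock2013, §2.2 L615–620 (arXiv:1108.1335v2 TeX)] -/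
theorem fineConst_eq_integral (hD : D.PosDef) (ha : a.PosSemidef) :
    fineConst D a Qm = ∫ Z : κ → ℝ, Real.exp (-(1/2 : ℝ) * (Z ⬝ᵥ gInvO D a Qm *ᵥ Z)) := by
  rw [fineConst, integral_exp_neg_half_quadForm _ (gInvO_posDef hD ha)]

omit [DecidableEq m] in
/-- `Z > 0` (*"Here Z_{k,Ω} is a constant"*). [cite: Dimock2013BalabanII, Thm 2.1 L603 (arXiv:1212.5562v2 TeX)] -/
theorem fineConst_pos (hD : D.PosDef) (ha : a.PosSemidef) : 0 < fineConst D a Qm :=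
  div_pos (pow_pos (Real.sqrt_pos.mpr (by positivity)) _) (Real.sqrt_pos.mpr (gInvO_posDef hD ha).det_pos)

omit [DecidableEq m] in
/-- **II THEOREM 2.1, THE `φ_{Ω₁}`-INTEGRATION (tony3) → (bombshell) = I (third) → (only)**: for every block field `Φ_{k,Ω}` and
every boundary source `src = [Δ]_{Ω₁,Ω₁ᶜ}φ_{Ω₁ᶜ}`,
`∫ dφ_{Ω₁} exp(−½‖𝐚^{1/2}(Φ_{k,Ω} − Q_{k,Ω}φ)‖² + ⟨φ, src⟩ − ½⟨φ, [−Δ + μ̄_k]_{Ω₁}φ⟩) = exp(−E(φ_{k,Ω})) · Z` with `φ_{k,Ω}` the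
minimizer (unknown) and `Z = fineConst` independent of `(Φ_{k,Ω}, src)` — *"Now in the exponent in (tony3) write φ_{Ω₁} =
φ_{k,Ω} + 𝒵 and integrate over 𝒵 instead of φ_{Ω₁}. The term with no 𝒵's comes outside the integral and gives the
exponential in (bombshell). The term linear in 𝒵 vanishes. The term quadratic in 𝒵 is −½⟨𝒵, [−Δ + μ̄_k +
Qᵀ_{k,Ω}𝐚Q_{k,Ω}]_{Ω₁}𝒵⟩."* (`MultiRegionFreeFlow.energy_eq_minimizer_add`, translation invariance, pv16's Gaussian integral);
I: *"We shift the integration in (third) so it is centered on the minimum … The cross terms vanish and so S_k(Φ_k, φ_k + 𝒵)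
= S_k(Φ_k, φ_k) + ½⟨𝒵, (−Δ + μ̄_k + a_kQ_kᵀQ_k)𝒵⟩. Then (third) becomes ρ_k(Φ_k) = Z_k exp(−S_k(Φ_k, φ_k))"*.
[cite: Dimock2013BalabanII, Thm 2.1 (sonnyboy) L594–614 with proof (tony3) L618–655 (arXiv:1212.5562v2 TeX); Dimock2013,
§2.2 (third)–(only) L570–620 (arXiv:1108.1335v2 TeX)] -/
theorem integral_exp_neg_energy (hD : D.PosDef) (ha : a.PosSemidef) (Φ : m → ℝ) (src : κ → ℝ) :
    ∫ φ : κ → ℝ, Real.exp (-energy D a Qm Φ src φ)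
      = Real.exp (-energy D a Qm Φ src (minimizer D a Qm Φ src)) * fineConst D a Qm := by
  have hsplit : ∀ φ : κ → ℝ, Real.exp (-energy D a Qm Φ src φ)
      = Real.exp (-energy D a Qm Φ src (minimizer D a Qm Φ src))
        * Real.exp (-(1/2 : ℝ) * ((φ - minimizer D a Qm Φ src) ⬝ᵥ
            gInvO D a Qm *ᵥ (φ - minimizer D a Qm Φ src))) := by
    intro φ
    rw [energy_eq_minimizer_add hD ha Φ src φ, ← Real.exp_add]
    congr 1
    ring
  have hfun : (fun φ : κ → ℝ => Real.exp (-energy D a Qm Φ src φ))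
      = fun φ => Real.exp (-energy D a Qm Φ src (minimizer D a Qm Φ src))
        * Real.exp (-(1/2 : ℝ) * ((φ - minimizer D a Qm Φ src) ⬝ᵥ
            gInvO D a Qm *ᵥ (φ - minimizer D a Qm Φ src))) := funext hsplit
  rw [hfun, integral_const_mul,
    integral_sub_right_eq_self (μ := (volume : Measure (κ → ℝ)))
      (fun Z : κ → ℝ => Real.exp (-(1/2 : ℝ) * (Z ⬝ᵥ gInvO D a Qm *ᵥ Z))) (minimizer D a Qm Φ src),
    ← fineConst_eq_integral hD ha]

omit [DecidableEq m] in
/-- the same without a boundary source (`src = 0`: the whole torus of I §2.2, or `φ_{Ω₁ᶜ} = 0`), with the value at the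
minimum in Lemma 2.2's form `S_k(Φ, φ_k) = ½⟨Φ, Δ_kΦ⟩` ((rain)/(spiffy), `MultiRegionFreeFlow.action_minimizer`):
`∫ dφ exp(−S_k(Φ_k, φ)) = Z · exp(−½⟨Φ_k, Δ_kΦ_k⟩)` — I (third) → (only) with (spiffy). [cite: Dimock2013, §2.2 (third)–(only)
L570–620 and (spiffy) L623–636 (arXiv:1108.1335v2 TeX); Dimock2013BalabanII, Lemma 2.2 (rain) L672–681 (arXiv:1212.5562v2
TeX)] -/
theorem integral_exp_neg_action (hD : D.PosDef) (ha : a.PosSemidef) (Φ : m → ℝ) :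
    ∫ φ : κ → ℝ, Real.exp (-action D a Qm Φ φ)
      = fineConst D a Qm * Real.exp (-(1/2 : ℝ) * (Φ ⬝ᵥ (DeltakO D a Qm *ᵥ Φ))) := by
  have h0 : ∀ φ : κ → ℝ, action D a Qm Φ φ = energy D a Qm Φ 0 φ := by
    intro φ; rw [energy, dotProduct_zero, sub_zero]
  simp_rw [h0]
  rw [integral_exp_neg_energy hD ha Φ 0, energy, dotProduct_zero, sub_zero, action_minimizer hD ha Φ 0,
    mulVec_zero, dotProduct_zero, mul_zero, add_zero, mul_comm, neg_mul]

end Sonnyboy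

/-! ## §6 A one-site instance -/

/-- one site per lattice, `Q = Q_k = 1`, `a_k = aL = 1`: `det(1 + 1·1) = 2`, `𝒵 = √(2π)/√2`, `a′ = ½`, so
`∫ exp(−½(Φ' − x)² − ½(x − φ)²) dx = (√(2π)/√2)·exp(−¼(Φ' − φ)²)`. -/
example (Φ' φ : Unit → ℝ) :
    ∫ x : Unit → ℝ, Real.exp (-stringy (1 : Matrix Unit Unit ℝ) (1 : Matrix Unit Unit ℝ) 1 1 Φ' φ x)
      = gaussConst (1 : Matrix Unit Unit ℝ) 1 1
        * Real.exp (-(aNext 1 1 / 2) * ((Φ' - (1 : Matrix Unit Unit ℝ) *ᵥ ((1 : Matrix Unit Unit ℝ) *ᵥ φ))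
            ⬝ᵥ (Φ' - (1 : Matrix Unit Unit ℝ) *ᵥ ((1 : Matrix Unit Unit ℝ) *ᵥ φ)))) :=
  integral_exp_neg_stringy (by simp) one_pos zero_le_one Φ' φ

/-- … with the constant evaluated: `det(a_k + aL·QᵀQ) = 1·(1 + 1)¹ = 2` there. -/
example : (oneStepH (1 : Matrix Unit Unit ℝ) 1 1).det = 2 := by
  rw [det_oneStepH (by simp) one_ne_zero]
  norm_num

end Literature.MathematicalPhysics.QuantumFieldTheory.Dimock2011to13.GaussianSingleStep

end
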